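import Literature.AlgebraicGeometry.HodgeTheory.QuaternionicQuarticGenericModelOfMinimalResolutions
import Summits.HodgeConjecture.HodgeConjecture.Theorems.Q8SymplecticPowersFamilyDeckOfGenericModel
import HarnessLib

/-!
# K1Q line `mechanism-v2`: the S6 deck-family ∃-package FROM MINIMAL RESOLUTIONS OF SURFACES (Kollár-free re-keying)

Route `HodgeConjecture/Q8SymplecticPowers`, crux K1Q `VeryGeneralQuaternionCommutatorsInHg` (stmt-HodgeConjecture-24190). Helper
(`--supports`; nothing here closes an item). Composition of `stub_familyDeckExistsQ_of_genericModel` with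
`Q8Family.exists_genericModel_of_minimalResolutions`: the deck-family ∃-package of the registered local-certificate stubs follows from

> **MINRES₂**: for every `e ≥ 2`, every integral projective scheme of dimension `2` over `Frac ℂ[a]` (`a` the `CIdx e` coefficients)
> has a minimal resolution (universal property `IsMinimalResolution`) whose source is projective

— Bădescu 2001 Thm. 4.3 ∕ Prop. 4.5 (Lipman 1969), a statement about surfaces only, replacing the all-dimension functorial-resolution
fact `Kollar2007_resolutionLiftsAutomorphisms` as far as the deck family is concerned.

Honest scope: a reduction; MINRES₂ is NOT proved in the tree; S6's registered form, LCERT, K1Q and HC are NOT proved here.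
-/

set_option linter.dupNamespace false

open CategoryTheory AlgebraicGeometry

namespace Summit.HodgeConjecture.HodgeConjecture.Theorems.Q8SymplecticPowersFamilyDeckOfMinimalResolutions

/-- **The S6 deck-family ∃-package from minimal resolutions of surfaces over `Frac ℂ[a]`** (consequent = the registered stub
`stub_familyDeckExistsQ` minus its Kollár binder, verbatim). [cite: Badescu2001, Thm. 4.3 and Prop. 4.5]
[cite: Kollar2007, Thm. 3.36 and §3.4.1] -/
theorem stub_familyDeckExistsQ_of_minimalResolutions
    (H : (∀ e : ℕ, 2 ≤ e → ∀ (N : Literature.AlgebraicGeometry.Motives.SchemeOver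
        (FractionRing (Literature.AlgebraicGeometry.HodgeTheory.Q8Family.ParamRing e)))
        [AlgebraicGeometry.IsIntegral N.left], Literature.AlgebraicGeometry.Motives.IsProjectiveOver N →
        topologicalKrullDim N.left = (2 : ℕ) →
        ∃ (Y : AlgebraicGeometry.Scheme) (r : Y ⟶ N.left), Literature.AlgebraicGeometry.Resolution.IsMinimalResolution r ∧
          Literature.AlgebraicGeometry.Motives.IsProjectiveOver (CategoryTheory.Over.mk (r ≫ N.hom)))) :
    open Literature.AlgebraicGeometry.Motives Literature.AlgebraicGeometry.HodgeTheory Literature.AlgebraicGeometry.HodgeTheory.BettiUniverse Literature.AlgebraicGeometry.HodgeTheory.Q8Family Literature.AlgebraicGeometry.RelativeSpec Literature.AlgebraicGeometry.RelativeSpec.ActionOver Literature.Algebra.Lie Literature.Algebra.Lie.KatzRecognition CategoryTheory CategoryTheory.Limits MonoidalCategory CartesianMonoidalCategory AlgebraicGeometry in ∀ ⦃e : ℕ⦄, Even e → 4 ≤ e → ∃ (W : (Spec (.of (ParamRing e))).Opens) (𝒳 : SchemeOver ℂ) (π : 𝒳 ⟶ base W) (τ j : 𝒳 ⟶ 𝒳)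 (ι : (deckChart (fun i => (MvPolynomial.X i : ParamRing e)) ⊗ Over.mk W.ι).left ⟶ 𝒳.left), Nonempty (ComplexPoints (base W)) ∧ IsSmoothProjectiveFamily π 2 ∧ IsQuasiProjectiveOver 𝒳 ∧ IsQuasiProjectiveOver (base W) ∧ AlgebraicGeometry.SmoothOfRelativeDimension (Fintype.card (CIdx e)) (base W).hom ∧ (τ ≫ π = π ∧ j ≫ π = π ∧ τ ≫ τ ≫ τ ≫ τ = 𝟙 𝒳 ∧ j ≫ j = τ ≫ τ ∧ τ ≫ j ≫ τ = j) ∧ IsOpenImmersion ι ∧ ι ≫ π.left = (snd (deckChart (fun i => (MvPolynomial.X i : ParamRing e))) (Over.mk W.ι)).left ∧ ((Over.isoMk ((deckAction (fun i => (MvPolynomial.X i : ParamRing e))).aut (QuaternionGroup.a 1)) ((deckAction (fun i => (MvPolynomial.X i : ParamRing e))).aut_comp (QuaternionGroup.a 1))).hom ▷ Over.mk W.ι).left ≫ ι = ι ≫ τ.left ∧ ((Over.isoMk ((deckAction (fun i => (MvPolynomial.X i : ParamRing e))).aut (QuaternionGroup.xa 0)) ((deckAction (fun i => (MvPolynomial.X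 i : ParamRing e))).aut_comp (QuaternionGroup.xa 0))).hom ▷ Over.mk W.ι).left ≫ ι = ι ≫ j.left ∧ Function.Surjective (snd (deckChart (fun i => (MvPolynomial.X i : ParamRing e))) (Over.mk W.ι)).left :=
  Q8SymplecticPowersFamilyDeckOfGenericModel.stub_familyDeckExistsQ_of_genericModel fun e he =>
    Literature.AlgebraicGeometry.HodgeTheory.Q8Family.exists_genericModel_of_minimalResolutions e he (H e he)

end Summit.HodgeConjecture.HodgeConjecture.Theorems.Q8SymplecticPowersFamilyDeckOfMinimalResolutions
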